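import Mathlib
import Summits.NavierStokesRegularity.NavierStokesRegularity.Theorems.EulerZoomLiouvillePowerGaugeEulerLiouvilleHoopAxisLawCentre
import Summits.NavierStokesRegularity.NavierStokesRegularity.Theorems.EulerZoomLiouvillePowerGaugeEulerLiouvilleHoopSliceMass
import Summits.NavierStokesRegularity.NavierStokesRegularity.Theorems.EulerZoomLiouvillePowerGaugeEulerLiouvilleHoopAxisChart
import HarnessLib

/-!
# Hoop core — t53-NET core: the NET axis pressure-drop law from a lateral energy bound (every cost term on the two end discs)

Sub-problem `NavierStokesRegularity`, crux `PowerGaugeEulerLiouville` (a crux CLASS of self-similar Euler/NS strata on the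
MODEL lattice — not NS regularity, not E).  Seat ns-ezl-w3 g7 (tag t53-NET; nsreg-p2 g40 ROUND-50 §1 `NsregP2.R50.AxisPressureDropLaw`;
LEAD 19832 ns-typeII-p2 g15 keys 04:09:19Z/04:16:26Z).  Class-free.

With the DISC MASS `dm(σ,T) = ∫₀^T t·⟨V_z⟩_θ(σ,t) dt` (inlined; `2π·dm` = axial volume flux through the disc `{y₂ = σ, r ≤ T}`):
* `hasDerivAt_discMass` — `∂_σ dm(σ,T) = ∫₀^T t·⟨D V_z[e_z]⟩_θ(σ,t) dt` (`V ∈ C¹`; `V_z` is globally smooth, so `…HoopCircleAvgCalculus`'s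
  global differentiation under `∫dθ` applies, then ns-ezl-w2's `hasDerivAt_intervalIntegral_of_continuous` under `∫dt`), continuous in `σ`;
* `radial_eq_neg_deriv_discMass` — the tree's `sliceMassIdentity` (p690507) in `HasDerivAt` form: `T·⟨V_r⟩_θ(σ,T) = −∂_σ dm(σ,T)`;
* `integral_radial_eq_discMass_sub` — σ-FTC: `∫_{s₁}^{s₂} T·⟨V_r⟩_θ(σ,T) dσ = dm(s₁,T) − dm(s₂,T)`;
* `integral_integral_radial_eq` — Fubini on `[s₁,s₂] × (0,T₀]` + the previous line at every radius:
  `∫_{s₁}^{s₂}∫₀^{T₀} ⟨V_r⟩_θ dt dσ = ∫₀^{T₀} (dm(s₁,t) − dm(s₂,t)) dt/t`;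
* `circleAvg_lateral_split` — on the wall circle `⟨(γr + V_r)V_r⟩_θ(σ,T₀) = γ·T₀⟨V_r⟩_θ(σ,T₀) + ⟨V_r²⟩_θ(σ,T₀)`;
* `integral_axisPressureDrop_le_of_lateral` — THE NET LAW from a lateral energy bound: for `IsSelfSimilarEulerProfile γ c V P`, `s₁ < s₂`,
  `0 < T₀`, and the LATERAL HOOP INEQUALITY INSTANCE `∫_Z hoopDensity + 2π∫⟨V_r²⟩_θ(σ,T₀)dσ ≤ 2∫_Z|DV|_F² + π∫(‖V(σe_z)‖² − V_z(σe_z)²) + endFlux(s₁) + endFlux(s₂)`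
  as a HYPOTHESIS (the LEAD's t53-LEL `lateralHoopInequality` discharges it): `2π∫(P(σe_z) − ⟨P⟩_θ(σ,T₀)) ≤ 2∫_Z|DV|_F² + endFlux(s₁) + endFlux(s₂)`
  `+ 2πγ(dm(s₁,T₀) − dm(s₂,T₀)) + 2π(1−3γ)∫₀^{T₀}(dm(s₁,t) − dm(s₂,t))dt/t + 2π[endTermC] − 2π[offsetTerm]` — every term except the energy lives
  on the two END DISCS (the wall's velocity and the interior speed never enter).  = `axisLawCentre` + hypothesis + `sliceMassIdentity`; the
  transverse axis atom cancels exactly.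
WHAT THIS IS NOT: not NS, not E — identities/inequalities for hypothetical profiles; 19832 OPEN; NS regularity NOT proved.  [nsreg-p2 g40 ROUND-50 §1]
-/

noncomputable section

open MeasureTheory Set WithLp Metric Real Function
open scoped InnerProductSpace RealInnerProductSpace Interval

set_option linter.dupNamespace false

namespace Summit.NavierStokesRegularity.NavierStokesRegularity.Theorems.PowerGaugeEulerLiouville.HoopCore

open Literature.Analysis Literature.Analysis.FluidPDE

variable {V : EuclideanSpace ℝ (Fin 3) → EuclideanSpace ℝ (Fin 3)}

/-! ## §1 The disc mass and its height derivative -/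

/-- `V_z` is `C¹` when `V` is. [folklore] -/
theorem contDiff_axialVelocity (hV : ContDiff ℝ 1 V) : ContDiff ℝ 1 (axialVelocity V) := by
  have e : axialVelocity V = fun y => (EuclideanSpace.proj (2 : Fin 3) : EuclideanSpace ℝ (Fin 3) →L[ℝ] ℝ) (V y) := by
    funext y; rfl
  rw [e]
  exact ((EuclideanSpace.proj (2 : Fin 3) : EuclideanSpace ℝ (Fin 3) →L[ℝ] ℝ).contDiff).comp hV

/-- **Height derivative of the disc mass**: `∂_σ ∫₀^T t·⟨V_z⟩_θ(σ,t) dt = ∫₀^T t·⟨D V_z[e_z]⟩_θ(σ,t) dt` (`V ∈ C¹`, every `σ`, every `T`). [folklore] -/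
theorem hasDerivAt_discMass (hV : ContDiff ℝ 1 V) (T σ : ℝ) :
    HasDerivAt (fun σ : ℝ => ∫ t in (0 : ℝ)..T, t * circleAvg (axialVelocity V) σ t)
      (∫ t in (0 : ℝ)..T, t * circleAvg (fun y => fderiv ℝ (axialVelocity V) y eZ) σ t) σ := by
  have hz : ContDiff ℝ 1 (axialVelocity V) := contDiff_axialVelocity hV
  have hzc : Continuous (axialVelocity V) := hz.continuous
  have hz'c : Continuous fun y => fderiv ℝ (axialVelocity V) y eZ := (hz.continuous_fderiv one_ne_zero).clm_apply continuous_const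
  have hF : Continuous (uncurry fun σ t : ℝ => t * circleAvg (axialVelocity V) σ t) :=
    continuous_snd.mul (continuous_circleAvg hzc)
  have hF' : Continuous (uncurry fun σ t : ℝ => t * circleAvg (fun y => fderiv ℝ (axialVelocity V) y eZ) σ t) :=
    continuous_snd.mul (continuous_circleAvg hz'c)
  exact hasDerivAt_intervalIntegral_of_continuous (fun σ t => (hasDerivAt_circleAvg_height hz σ t).const_mul t) hF hF' 0 T σ

/-- The height derivative of the disc mass is continuous in `σ` (`V ∈ C¹`). [folklore] -/
theorem continuous_deriv_discMass (hV : ContDiff ℝ 1 V) (T : ℝ) :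
    Continuous fun σ : ℝ => ∫ t in (0 : ℝ)..T, t * circleAvg (fun y => fderiv ℝ (axialVelocity V) y eZ) σ t := by
  have hz : ContDiff ℝ 1 (axialVelocity V) := contDiff_axialVelocity hV
  have hz'c : Continuous fun y => fderiv ℝ (axialVelocity V) y eZ := (hz.continuous_fderiv one_ne_zero).clm_apply continuous_const
  exact intervalIntegral.continuous_parametric_intervalIntegral_of_continuous'
    (continuous_snd.mul (continuous_circleAvg hz'c)) 0 T

/-- **The slice mass identity in `HasDerivAt` form**: `T·⟨V_r⟩_θ(σ,T) = −∂_σ dm(σ,T)` for `C¹` divergence-free `V`, `T > 0`. [nsreg-p2 R48 §1.2] -/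
theorem radial_eq_neg_deriv_discMass (hV : ContDiff ℝ 1 V) (hdiv : ∀ y, VectorCalculus.divergence V y = 0) (σ : ℝ) {T : ℝ}
    (hT : 0 < T) :
    T * circleAvg (radialVelocity V) σ T = -(∫ t in (0 : ℝ)..T, t * circleAvg (fun y => fderiv ℝ (axialVelocity V) y eZ) σ t) := by
  rw [sliceMassIdentity V hV hdiv σ T hT, (hasDerivAt_discMass hV T σ).deriv]

/-- **σ-FTC for the wall term**: `∫_{s₁}^{s₂} T·⟨V_r⟩_θ(σ,T) dσ = dm(s₁,T) − dm(s₂,T)` (`C¹` divergence-free `V`, `T > 0`). [folklore] -/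
theorem integral_radial_eq_discMass_sub (hV : ContDiff ℝ 1 V) (hdiv : ∀ y, VectorCalculus.divergence V y = 0) (s₁ s₂ : ℝ) {T : ℝ}
    (hT : 0 < T) :
    ∫ σ in s₁..s₂, T * circleAvg (radialVelocity V) σ T =
      (∫ t in (0 : ℝ)..T, t * circleAvg (axialVelocity V) s₁ t) - (∫ t in (0 : ℝ)..T, t * circleAvg (axialVelocity V) s₂ t) := by
  have hFTC := intervalIntegral.integral_eq_sub_of_hasDerivAt (a := s₁) (b := s₂) (fun σ _ => hasDerivAt_discMass hV T σ)
    ((continuous_deriv_discMass hV T).intervalIntegrable _ _)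
  rw [intervalIntegral.integral_congr (fun σ _ => radial_eq_neg_deriv_discMass hV hdiv σ hT), intervalIntegral.integral_neg, hFTC]
  ring

/-! ## §2 Fubini for the radial double integral -/

/-- **The radial double integral through the end discs**: for `C¹` divergence-free `V`, `s₁ ≤ s₂`, `0 ≤ T₀`,
`∫_{s₁}^{s₂} ∫₀^{T₀} ⟨V_r⟩_θ(σ,t) dt dσ = ∫₀^{T₀} (dm(s₁,t) − dm(s₂,t))/t dt` (Fubini in the chart, then the σ-FTC at every radius). [folklore] -/
theorem integral_integral_radial_eq (hV : ContDiff ℝ 1 V) (hdiv : ∀ y, VectorCalculus.divergence V y = 0) {s₁ s₂ T₀ : ℝ}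
    (hs : s₁ ≤ s₂) (hT₀ : 0 ≤ T₀) :
    ∫ σ in s₁..s₂, ∫ t in (0 : ℝ)..T₀, circleAvg (radialVelocity V) σ t =
      ∫ t in (0 : ℝ)..T₀, ((∫ τ in (0 : ℝ)..t, τ * circleAvg (axialVelocity V) s₁ τ)
        - (∫ τ in (0 : ℝ)..t, τ * circleAvg (axialVelocity V) s₂ τ)) / t := by
  have hVc : Continuous V := hV.continuous
  -- the chart form of `⟨V_r⟩`, jointly continuous on `ℝ × ℝ`
  set f : ℝ → ℝ → ℝ := fun σ t => 1 / (2 * Real.pi) * ∫ θ in (0 : ℝ)..2 * Real.pi,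
    ⟪V (axisPt σ t θ), rotZ θ (EuclideanSpace.single (0 : Fin 3) (1 : ℝ))⟫ with hf
  have hfc : Continuous (uncurry f) := by
    rw [hf]
    exact continuous_const.mul (continuous_parametric₂_intervalIntegral
      (F := fun σ t θ => ⟪V (axisPt σ t θ), rotZ θ (EuclideanSpace.single (0 : Fin 3) (1 : ℝ))⟫) (continuous_sliceA hVc) _ _)
  have hfeq : ∀ σ : ℝ, ∀ t ∈ Ioc 0 T₀, circleAvg (radialVelocity V) σ t = f σ t := fun σ t ht => by
    rw [hf]; exact circleAvg_radialVelocity_eq_chart V σ ht.1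
  -- replace the integrand by the chart form on both sides
  have hL : ∫ σ in s₁..s₂, ∫ t in (0 : ℝ)..T₀, circleAvg (radialVelocity V) σ t = ∫ σ in s₁..s₂, ∫ t in (0 : ℝ)..T₀, f σ t := by
    refine intervalIntegral.integral_congr fun σ _ => ?_
    refine intervalIntegral.integral_congr_ae (ae_of_all _ fun t ht => ?_)
    rw [uIoc_of_le hT₀] at ht
    exact hfeq σ t ht
  have hR : ∫ t in (0 : ℝ)..T₀, ((∫ τ in (0 : ℝ)..t, τ * circleAvg (axialVelocity V) s₁ τ)
        - (∫ τ in (0 : ℝ)..t, τ * circleAvg (axialVelocity V) s₂ τ)) / t =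
      ∫ t in (0 : ℝ)..T₀, ∫ σ in s₁..s₂, f σ t := by
    refine intervalIntegral.integral_congr_ae (ae_of_all _ fun t ht => ?_)
    rw [uIoc_of_le hT₀] at ht
    have h1 := integral_radial_eq_discMass_sub hV hdiv s₁ s₂ ht.1
    rw [← h1, div_eq_iff ht.1.ne', ← intervalIntegral.integral_mul_const]
    exact intervalIntegral.integral_congr fun σ _ => by rw [hfeq σ t ht, mul_comm]
  rw [hL, hR]
  -- Fubini on `(s₁, s₂] × (0, T₀]` for the continuous `f`
  rw [intervalIntegral.integral_of_le hs, intervalIntegral.integral_of_le hT₀]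
  simp_rw [intervalIntegral.integral_of_le hT₀, intervalIntegral.integral_of_le hs]
  have hint : Integrable (uncurry f) ((volume.restrict (Ioc s₁ s₂)).prod (volume.restrict (Ioc 0 T₀))) := by
    rw [Measure.prod_restrict, ← Measure.volume_eq_prod]
    exact (hfc.continuousOn.integrableOn_compact (isCompact_Icc.prod isCompact_Icc)).mono_set
      (prod_mono Ioc_subset_Icc_self Ioc_subset_Icc_self)
  exact integral_integral_swap hint

/-! ## §3 The wall term splits; the NET law from a lateral energy bound -/

/-- **On the wall circle `⟨(γr + V_r)V_r⟩_θ(σ,T₀) = γ·T₀⟨V_r⟩_θ(σ,T₀) + ⟨V_r²⟩_θ(σ,T₀)`** (`V` continuous, `T₀ > 0`). [folklore] -/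
theorem circleAvg_lateral_split (hV : Continuous V) (γ σ : ℝ) {T₀ : ℝ} (hT₀ : 0 < T₀) :
    circleAvg (fun y => (γ * cylRadius y + radialVelocity V y) * radialVelocity V y) σ T₀ =
      γ * (T₀ * circleAvg (radialVelocity V) σ T₀) + circleAvg (fun y => radialVelocity V y ^ 2) σ T₀ := by
  have hA : Continuous fun θ : ℝ => radialVelocity V (axisPt σ T₀ θ) := by
    have h := continuous_along_angle (continuous_sliceA hV) σ T₀
    refine h.congr fun θ => ?_
    exact inner_rotZ_single_zero_eq_radialVelocity V σ hT₀ θ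
  have h1 : IntervalIntegrable (fun θ : ℝ => γ * T₀ * radialVelocity V (axisPt σ T₀ θ)) volume 0 (2 * Real.pi) :=
    (continuous_const.mul hA).intervalIntegrable _ _
  have h2 : IntervalIntegrable (fun θ : ℝ => radialVelocity V (axisPt σ T₀ θ) ^ 2) volume 0 (2 * Real.pi) :=
    (hA.pow 2).intervalIntegrable _ _
  unfold circleAvg
  rw [intervalIntegral.integral_congr (g := fun θ => γ * T₀ * radialVelocity V (axisPt σ T₀ θ) + radialVelocity V (axisPt σ T₀ θ) ^ 2)
    (fun θ _ => by simp only [cylRadius_axisPt σ hT₀.le θ]; ring),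
    intervalIntegral.integral_add h1 h2, intervalIntegral.integral_const_mul]
  ring

/-- **t53-NET CORE — THE NET AXIS PRESSURE-DROP LAW FROM A LATERAL ENERGY BOUND.**  For a `C²` profile pair
`IsSelfSimilarEulerProfile γ c V P` (any centre `c`), `s₁ < s₂`, `0 < T₀`, `Z = solidCyl s₁ s₂ T₀`, ASSUMING the lateral hoop inequality
instance `∫_Z hoopDensity + 2π∫⟨V_r²⟩_θ(σ,T₀)dσ ≤ 2∫_Z|DV|_F² + π∫(‖V(σe_z)‖² − V_z(σe_z)²)dσ + endFlux(s₁) + endFlux(s₂)`: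
`2π∫_{s₁}^{s₂}(P(σe_z) − ⟨P⟩_θ(σ,T₀))dσ ≤ 2∫_Z|DV|_F² + endFlux(s₁) + endFlux(s₂) + 2πγ(dm(s₁,T₀) − dm(s₂,T₀))`
`+ 2π(1−3γ)∫₀^{T₀}(dm(s₁,t) − dm(s₂,t))dt/t + 2π([endTermC]_{s₁}^{s₂}) − 2π([offsetTerm]_{s₁}^{s₂})`, `dm(σ,T) = ∫₀^T t⟨V_z⟩_θ(σ,t)dt`.
[nsreg-p2 g40 ROUND-50 §1 `AxisPressureDropLaw`] -/
theorem integral_axisPressureDrop_le_of_lateral {γ : ℝ} {c : EuclideanSpace ℝ (Fin 3)} {P : EuclideanSpace ℝ (Fin 3) → ℝ}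
    (hprof : IsSelfSimilarEulerProfile γ c V P) {s₁ s₂ T₀ : ℝ} (hs : s₁ < s₂) (hT₀ : 0 < T₀)
    (hlat : (∫ y in solidCyl s₁ s₂ T₀, hoopDensity V y)
        + 2 * Real.pi * (∫ σ in s₁..s₂, circleAvg (fun y => radialVelocity V y ^ 2) σ T₀)
      ≤ 2 * (∫ y in solidCyl s₁ s₂ T₀, frobeniusNormSq (fderiv ℝ V y))
        + Real.pi * (∫ σ in s₁..s₂, (‖V (σ • eZ)‖ ^ 2 - (axialVelocity V (σ • eZ)) ^ 2))
        + endFlux V s₁ T₀ + endFlux V s₂ T₀) :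
    2 * Real.pi * (∫ σ in s₁..s₂, (P (σ • eZ) - circleAvg P σ T₀))
      ≤ 2 * (∫ y in solidCyl s₁ s₂ T₀, frobeniusNormSq (fderiv ℝ V y))
        + endFlux V s₁ T₀ + endFlux V s₂ T₀
        + 2 * Real.pi * γ * ((∫ t in (0 : ℝ)..T₀, t * circleAvg (axialVelocity V) s₁ t)
            - (∫ t in (0 : ℝ)..T₀, t * circleAvg (axialVelocity V) s₂ t))
        + 2 * Real.pi * (1 - 3 * γ) * (∫ t in (0 : ℝ)..T₀, ((∫ τ in (0 : ℝ)..t, τ * circleAvg (axialVelocity V) s₁ τ)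
            - (∫ τ in (0 : ℝ)..t, τ * circleAvg (axialVelocity V) s₂ τ)) / t)
        + 2 * Real.pi * (endTermC γ c V T₀ s₂ - endTermC γ c V T₀ s₁)
        - 2 * Real.pi * (offsetTerm γ c V T₀ s₂ - offsetTerm γ c V T₀ s₁) := by
  have hV1 : ContDiff ℝ 1 V := hprof.contDiff_velocity.of_le (by norm_num)
  have hVc : Continuous V := hprof.contDiff_velocity.continuous
  have hdiv : ∀ y, VectorCalculus.divergence V y = 0 := hprof.divFree
  have hAX := axisLawCentre γ c V P hprof s₁ s₂ T₀ hs.le hT₀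
  have hhoop := integral_axisHoopTerm_eq_hoopDensity hV1 hs.le hT₀
  have hDI := integral_integral_radial_eq hV1 hdiv hs.le hT₀.le
  -- the wall term: split and integrate the mass part by FTC
  have hwall : ∫ σ in s₁..s₂, circleAvg (fun y => (γ * cylRadius y + radialVelocity V y) * radialVelocity V y) σ T₀ =
      γ * ((∫ t in (0 : ℝ)..T₀, t * circleAvg (axialVelocity V) s₁ t) - (∫ t in (0 : ℝ)..T₀, t * circleAvg (axialVelocity V) s₂ t))
        + ∫ σ in s₁..s₂, circleAvg (fun y => radialVelocity V y ^ 2) σ T₀ := by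
    have hmass := integral_radial_eq_discMass_sub hV1 hdiv s₁ s₂ hT₀
    -- continuity in `σ` of the two pieces (for the splitting of the integral)
    have hc1 : Continuous fun σ : ℝ => T₀ * circleAvg (radialVelocity V) σ T₀ := by
      have h := (continuous_deriv_discMass hV1 T₀).neg
      refine h.congr fun σ => ?_
      rw [Pi.neg_apply, radial_eq_neg_deriv_discMass hV1 hdiv σ hT₀]
    have hc2 : Continuous fun σ : ℝ => circleAvg (fun y => radialVelocity V y ^ 2) σ T₀ := by
      have h : Continuous fun σ : ℝ => 1 / (2 * Real.pi) * ∫ θ in (0 : ℝ)..2 * Real.pi,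
          ⟪V (axisPt σ T₀ θ), rotZ θ (EuclideanSpace.single (0 : Fin 3) (1 : ℝ))⟫ ^ 2 :=
        continuous_const.mul (intervalIntegral.continuous_parametric_intervalIntegral_of_continuous'
          ((continuous_uncurry_radius (continuous_sliceA hVc) T₀).pow 2) _ _)
      refine h.congr fun σ => ?_
      unfold circleAvg
      congr 1
      exact intervalIntegral.integral_congr fun θ _ => by rw [inner_rotZ_single_zero_eq_radialVelocity V σ hT₀ θ]
    have i1 : IntervalIntegrable (fun σ : ℝ => γ * (T₀ * circleAvg (radialVelocity V) σ T₀)) volume s₁ s₂ :=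
      (continuous_const.mul hc1).intervalIntegrable _ _
    have i2 : IntervalIntegrable (fun σ : ℝ => circleAvg (fun y => radialVelocity V y ^ 2) σ T₀) volume s₁ s₂ :=
      hc2.intervalIntegrable _ _
    rw [intervalIntegral.integral_congr (fun σ _ => circleAvg_lateral_split hVc γ σ hT₀),
      intervalIntegral.integral_add i1 i2, intervalIntegral.integral_const_mul, hmass]
  rw [hAX, hhoop, hDI, hwall]
  have e : 2 * Real.pi * (1 / (2 * Real.pi) * ∫ y in solidCyl s₁ s₂ T₀, hoopDensity V y) = ∫ y in solidCyl s₁ s₂ T₀, hoopDensity V y := by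
    field_simp
  linarith [hlat, e]

end Summit.NavierStokesRegularity.NavierStokesRegularity.Theorems.PowerGaugeEulerLiouville.HoopCore

end
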